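import Summits.BirchSwinnertonDyer.BirchSwinnertonDyer.Theorems.OneSidedTwistSqueezeX9KatoDivisibilityX9KolyvaginReciprocityPkTameClass
import Summits.BirchSwinnertonDyer.BirchSwinnertonDyer.Theorems.OneSidedTwistSqueezeX9KatoDivisibilityX9KolyvaginReciprocityPkEulerFactor
import Summits.BirchSwinnertonDyer.BirchSwinnertonDyer.Theorems.OneSidedTwistSqueezeX9KatoDivisibilityX9StubReciprocityPkX9Local
import Summits.BirchSwinnertonDyer.BirchSwinnertonDyer.Theorems.SmallImageMuTransferMuTransferX9TameClassValueInput
import HarnessLib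

set_option autoImplicit false

-- the summit and its single problem are both named `BirchSwinnertonDyer` (registry layout D-0017)
set_option linter.dupNamespace false

/-!
# Crux `KatoDivisibilityX9` (stmt-BirchSwinnertonDyer-20547), line `graded_euler_loss`, stub
# `stub_reciprocityPkAX9` (hG34ᵍ), item (M1) of `hKolyRecPk`, file 5 (= (M1) ASSEMBLED): the VALUE INPUT of
# the level-`p^{k+1}` Kolyvagin cocycle — the genuine tame cocycle `y'` on `N = Gal(ℚ̄/ℚ(μ_ℓ))` with values in
# `𝒯_L^{(k+1)}(E)` at ANY level `L`, integral, with norm relation `cor_N [y'] = [ψ']`,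
# `ψ'(g) = (φ̃ − 1)((φ̃ − 1)(φ(g)))`, `φ̃ = (1+S)^{p^N u}` THE ACTION OF EVERY LOCAL FROBENIUS AT `q` ON `𝒯_L^{(k+1)}`

Seat `bsd-line-k6-p4` (prover-bsd-line-k6-p4-g5-0, wave-2 stub worker B).  THEOREMS ONLY (no definition, no named
fact, no `sorry`); nothing is asserted about any curve; `--supports stmt-BirchSwinnertonDyer-20547 --as helper`.
Level-`p^{k+1}` twin of koly's `TameClass.exists_tameCocycle_valueInput` (`…X9TameClassValueInput`, the input of
x10's `KolyvaginTwist.exists_kolyvaginCocycle_value`): item (M1) of the wave-1 worker's audit of stub 1c / 1c'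
(`StubReciprocityPkX9.notes.md`: "the tame value input of `IsEulerSystemClass` reduced mod `p^{d+1}`: `y' ∈
Z¹(Gal(ℚ̄/ℚ(μ_q)), modPkTwist (d+1) L)`, `Cor y' = [P_q(g⁻¹)·φ]`, `P_q(g⁻¹) = unit·(g−1)(g−q) mod p^{d+1}`").

* **`exists_tameCocycle_valueInputPk`** — for `IsEulerSystemClass W p κ γ I s`: a finite `S₀` such that for every
  `q ∉ S₀` (prime `ℓ`), `𝔓 ∣ q`, an `E[p^{k+1}]`-SPLIT arithmetic Frobenius `Fr` at `𝔓` of depth exactly `N` and EVERY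
  level `L`: `(p) ∉ q`, `E[p^{k+1}]` unramified at `q`, `p^{k+1} ∣ ℓ − 1`, and `∃ u y'`, `p ∤ u`, (act) every local
  arithmetic Frobenius `r` of `ℚ_q` acts on `𝒯_L^{(k+1)}(E)` by `φ̃ := (1+S)^{p^N u}`, (I1) `y'` is integral, and for
  every cocycle `φ` of `(I.redTowerPk (k+1) s)_L` a cocycle `ψ'` with `ψ'(g) = (φ̃−1)((φ̃−1)(φ g))` and
  `cor_N [y'] = [ψ']`.  Ingredients: file 3 (the tame class mod `p^{k+1}` at layer `n' = L + (k+1) + N`, level `L`),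
  file 4 (the Euler factor is `(1 − X)²` mod `p^{k+1}`, `p^{k+1} ∣ ℓ − 1`), koly's `aeval_one_sub_X_sq_apply`,
  x9's depth lemma `twistExponent_eq_prime_pow_mul_of_depth` and `isSplit_and_depth_absGaloisRestrict_of_isArithFrobAt`,
  k6-g3's `apply_absGaloisRestrict_eq_of_isArithFrobAt` (`κ(res r) = κ(Fr)`).
  NOTE (what is NOT here, honest): the clause `hψJ` of the mod-`p` model (`ψ' ≡ 0 (mod T^J)`) has no level-`p^k`
  analogue at the truncation; the consumer (item (M2)) kills `ψ'` with the projection `x ↦ m(S)·x`, `m = T^{2e(k+1)}/ω²`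
  (`ω = (X+1)^{p^N} − 1`), for which `m·((X+1)^{p^N u} − 1)² ≡ 0 (mod p^{k+1}, X^{2e(k+1)})`.

References: K. Kato, Astérisque 295 (2004) (8.1.3), (13.1.1), Ex. 13.3, §13.8 [Kato2004Asterisque]; K. Rubin, *Euler
Systems* (2000) §4.4; L. Washington, GTM 83, §13.1–13.2, Prop. 13.2 [Washington1997]; B. Mazur, K. Rubin, Mem. AMS 799
(2004) §5.3 [MazurRubin2004].
-/

noncomputable section

open CategoryTheory Function Finset Polynomial
open scoped NumberField Pointwise ContRepresentation
open Field IsDedekindDomain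
open Literature.NumberTheory.GaloisRepresentations
open Literature.NumberTheory.GaloisRepresentations.IsNonarchimedeanLocalField
open Literature.NumberTheory.EllipticCurves
open Literature.NumberTheory.EllipticCurves.ZpExtension
open Literature.NumberTheory.EllipticCurves.Kato2004
open Literature.NumberTheory.EllipticCurves.Kato2004.EulerSystemValues
open Rat.HeightOneSpectrum
open WeierstrassCurve (geomPoints geomTorsion galoisRepTorsion)
open Summit.BirchSwinnertonDyer.Rank1Residual.GaloisImage
open Summit.BirchSwinnertonDyer.BirchSwinnertonDyer.Rank1Residual
open Summit.BirchSwinnertonDyer.BirchSwinnertonDyer.Theorems.OneSidedTwistSqueezeX9KatoDivisibilityX9KolyvaginReciprocityPkTameClass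
open Summit.BirchSwinnertonDyer.BirchSwinnertonDyer.Theorems.OneSidedTwistSqueezeX9KatoDivisibilityX9KolyvaginReciprocityPkEulerFactor
open Summit.BirchSwinnertonDyer.BirchSwinnertonDyer.Theorems.OneSidedTwistSqueezeX9KatoDivisibilityX9StubReciprocityPkX9Local

namespace Summit.BirchSwinnertonDyer.BirchSwinnertonDyer.Theorems.OneSidedTwistSqueezeX9KatoDivisibilityX9KolyvaginReciprocityPkValueInput

variable (W : WeierstrassCurve ℚ) [W.IsElliptic] [W.IsGloballyMinimal] (p : ℕ) [Fact p.Prime] (k : ℕ)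
  [ContinuousSMul ℤ_[p] (W.tateModule p)]
  [Module.Free ℤ_[p] (W.tateModule p)] [Module.Finite ℤ_[p] (W.tateModule p)]
  (κ : ZpExtension ℚ p) (γ : absoluteGaloisGroup ℚ) (I : IwasawaH1Data W p κ γ)

/-- **THE VALUE INPUT of the level-`p^{k+1}` Kolyvagin cocycle (item (M1) of `hKolyRecPk`, operator form at the
local Frobenius).**  For a genuine Λ-adic Euler-system class `s` there is a finite `S₀` such that for every `q ∉ S₀`
(prime `ℓ`), `𝔓 ∣ q`, `E[p^{k+1}]`-split arithmetic Frobenius `Fr` at `𝔓` (`galoisRepTorsion W ((p:ℤ)^(k+1)) Fr = 1`)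
of depth `N` (`Fr ∈ Γ_N ∖ Γ_{N+1}`) and every level `L`: `q ∤ p`, `E[p^{k+1}]` is unramified at `q`,
`p^{k+1} ∣ ℓ − 1`, and there are `u` with `p ∤ u` and a cocycle `y'` on `N = Gal(ℚ̄/ℚ(μ_ℓ))` in
`𝒯_L^{(k+1)}(E) = E[p^{k+1}] ⊗ (ℤ/p^{k+1})[T]/(T^L)(χ_κ)` such that: (act) EVERY local arithmetic Frobenius `r` of `ℚ_q`
acts on `𝒯_L^{(k+1)}(E)` by `φ̃ := (1+S)^{p^N u}`; (I1) `y'` is integral (vanishes in `H¹(N ∩ I_{𝔓'}, ·)` for all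
`𝔓' ∣ w ∤ p`); and for every cocycle `φ` of `(I.redTowerPk (k+1) s)_L` there is a cocycle `ψ'` with VALUES
`ψ'(g) = (φ̃ − 1)((φ̃ − 1)(φ(g)))` and the norm relation `cor_N [y'] = [ψ']`.  Kato's (13.1.1)/Ex. 13.3 read modulo
`(p^{k+1}, T^L)`: `P_q(Fr⁻¹) ≡ (Fr⁻¹ − 1)² (mod p^{k+1})` since `a_q ≡ 2`, `q ≡ 1`.
[cite: Kato2004Asterisque, (8.1.3), §13.1 (13.1.1) and Ex. 13.3] [cite: Washington1997, §13.1–§13.2 and Prop. 13.2]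
[cite: MazurRubin2004, §5.3] -/
theorem exists_tameCocycle_valueInputPk {s : I.H} (hES : IsEulerSystemClass W p κ γ I s) :
    ∃ S₀ : Set (HeightOneSpectrum (𝓞 ℚ)), S₀.Finite ∧
      ∀ (q : HeightOneSpectrum (𝓞 ℚ)), q ∉ S₀ →
      ∀ {𝔓 : Ideal (absIntegers (𝓞 ℚ) ℚ)}, 𝔓 ∈ q.primesAbove →
      ∀ {Fr : absoluteGaloisGroup ℚ}, IsArithFrobAt (𝓞 ℚ) Fr 𝔓 →
        galoisRepTorsion W ((p : ℤ) ^ (k + 1)) Fr = 1 →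
      ∀ {N : ℕ}, Fr ∈ κ.layerSubgroup N → Fr ∉ κ.layerSubgroup (N + 1) →
      ∀ (L : ℕ) [NeZero ((primesEquiv q : Nat.Primes) : ℕ)]
        [Fintype (absoluteGaloisGroup ℚ ⧸ rootsOfUnityFixer ℚ ((primesEquiv q : Nat.Primes) : ℕ))],
      (p : 𝓞 ℚ) ∉ q.asIdeal ∧ GaloisRep.IsUnramifiedAt q (W.torsionGaloisModule ((p : ℤ) ^ (k + 1))) ∧
      p ^ (k + 1) ∣ ((primesEquiv q : Nat.Primes) : ℕ) - 1 ∧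
      ∃ (u : ℕ) (y' : contOneCocycles (subgroupRep (κ.twistModPk (W.torsionGaloisModule ((p : ℤ) ^ (k + 1)))
            (W.pow_nsmul_geomTorsion_eq_zero p (k + 1)) L).toTopRep
            (rootsOfUnityFixer ℚ ((primesEquiv q : Nat.Primes) : ℕ)))),
        ¬ p ∣ u ∧
        -- (act) every local Frobenius at `q` acts on `𝒯_L^{(k+1)}` by `(1+S)^{p^N u}`
        (∀ r : absoluteGaloisGroup (q.adicCompletion ℚ), IsAbsArithFrob r →
          ∀ x : Fin L → geomTorsion W ((p : ℤ) ^ (k + 1)),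
            κ.twistModPk (W.torsionGaloisModule ((p : ℤ) ^ (k + 1)))
              (W.pow_nsmul_geomTorsion_eq_zero p (k + 1)) L (absGaloisRestrict ℚ (q.adicCompletion ℚ) r) x =
            unipotentPow (geomTorsion W ((p : ℤ) ^ (k + 1))) L (p ^ N * u) x) ∧
        -- (I1) integrality of `y'`
        (∀ w : HeightOneSpectrum (𝓞 ℚ), (p : 𝓞 ℚ) ∉ w.asIdeal → ∀ 𝔓' ∈ w.primesAbove,
          resLe (κ.twistModPk (W.torsionGaloisModule ((p : ℤ) ^ (k + 1)))
              (W.pow_nsmul_geomTorsion_eq_zero p (k + 1)) L).toTopRep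
            (inf_le_left : rootsOfUnityFixer ℚ ((primesEquiv q : Nat.Primes) : ℕ) ⊓
              𝔓'.inertia (absoluteGaloisGroup ℚ) ≤ _) 1 (oneCocycleClass _ y') = 0) ∧
        -- the norm relation in operator form
        ∀ φ : contOneCocycles (κ.twistModPk (W.torsionGaloisModule ((p : ℤ) ^ (k + 1)))
            (W.pow_nsmul_geomTorsion_eq_zero p (k + 1)) L).toTopRep,
          oneCocycleClass _ φ = (I.redTowerPk (k + 1) s : ∀ J : ℕ, galoisCohomology (κ.twistModPk
            (W.torsionGaloisModule ((p : ℤ) ^ (k + 1))) (W.pow_nsmul_geomTorsion_eq_zero p (k + 1)) J) 1) L →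
          ∃ ψ' : contOneCocycles (κ.twistModPk (W.torsionGaloisModule ((p : ℤ) ^ (k + 1)))
              (W.pow_nsmul_geomTorsion_eq_zero p (k + 1)) L).toTopRep,
            (∀ g, ψ'.1 g =
              (unipotentPow (geomTorsion W ((p : ℤ) ^ (k + 1))) L (p ^ N * u) - 1)
                ((unipotentPow (geomTorsion W ((p : ℤ) ^ (k + 1))) L (p ^ N * u) - 1) (φ.1 g))) ∧
            cores (κ.twistModPk (W.torsionGaloisModule ((p : ℤ) ^ (k + 1)))
                (W.pow_nsmul_geomTorsion_eq_zero p (k + 1)) L).toTopRep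
              (rootsOfUnityFixer ℚ ((primesEquiv q : Nat.Primes) : ℕ))
              (isOpen_rootsOfUnityFixer ℚ _) (oneCocycleClass _ y') = oneCocycleClass _ ψ' := by
  classical
  have hp : p.Prime := Fact.out
  obtain ⟨S₀, hS₀, hmain⟩ := exists_tameClassPk_of_isEulerSystemClass W p (k + 1) κ γ I hES
  obtain ⟨S₁, hS₁, hsub₁, hgood₁⟩ :=
    TorsionUnramified.exists_finite_superset_isUnramifiedAt_torsionGaloisModule W (K := ℚ)
      (p := p) hp.ne_zero hS₀
  obtain ⟨S₂, hS₂, hsub₂, hgood₂⟩ :=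
    TorsionUnramified.exists_finite_superset_isUnramifiedAt_torsionGaloisModule W (K := ℚ)
      (p := p ^ (k + 1)) (pow_ne_zero _ hp.ne_zero) hS₁
  refine ⟨S₂, hS₂, ?_⟩
  intro q hq2 𝔓 h𝔓 Fr hFr hsplit N hFrN hFrN' L _ _
  have hq1 : q ∉ S₁ := fun h ↦ hq2 (hsub₂ h)
  have hq0 : q ∉ S₀ := fun h ↦ hq1 (hsub₁ h)
  obtain ⟨hqp, hqgood, -⟩ := hgood₁ q hq1
  have hunr : GaloisRep.IsUnramifiedAt q (W.torsionGaloisModule ((p : ℤ) ^ (k + 1))) := by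
    have h := (hgood₂ q hq2).2.2
    rwa [Nat.cast_pow] at h
  have hne : ((primesEquiv q : Nat.Primes) : ℕ) ≠ p := TameClass.primesEquiv_ne_of_natCast_not_mem hqp
  have hFr' : IsArithFrobAtPlace ℚ q Fr := ⟨𝔓, h𝔓, hFr⟩
  -- `q ≡ 1`, `P ≡ (1 − X)² (mod p^{k+1})`
  obtain ⟨hq1', -⟩ :=
    natCast_eq_one_and_frobeniusTrace_eq_two_of_galoisRepTorsion_pow_eq_one W p k hne hqgood hFr' hsplit
  have hdvd : p ^ (k + 1) ∣ ((primesEquiv q : Nat.Primes) : ℕ) - 1 :=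
    pow_dvd_primesEquiv_sub_one_of_natCast_eq_one p k hq1'
  have hPz : ((1 - X) ^ 2 : ℤ[X]).map (Int.castRingHom (ZMod (p ^ (k + 1)))) =
      (rubinEulerFactor (tateRep W p).toRepresentation (cyclotomicCharacterToUnits ℚ p ℤ_[p]) Fr).map
        (PadicInt.toZModPow (k + 1)) :=
    (map_toZModPow_rubinEulerFactor_eq_of_galoisRepTorsion_pow_eq_one W p k hne hqgood hFr' hsplit).symm
  -- the layer `n' = L + (k+1) + N` (admissible for the level `L`, deeper than the depth `N`) and the exponent
  set n' : ℕ := L + (k + 1) + N with hn'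
  have hadm : L ≤ p ^ (n' + 1 - (k + 1)) :=
    (show L ≤ n' + 1 - (k + 1) by omega).trans (Nat.lt_pow_self hp.one_lt).le
  obtain ⟨u, hu, ha⟩ := LocalSplitPrime.twistExponent_eq_prime_pow_mul_of_depth κ (J := n')
    (by omega : N + 1 ≤ n') hFrN hFrN'
  have ha' : ((p ^ N * u : ℕ) : ZMod (p ^ n')) = κ.layerIndex n' Fr := by
    rw [← ha]
    exact κ.natCast_twistExponent n' n' le_rfl Fr
  obtain ⟨y, hyint, hynorm⟩ := hmain q hq0 n' L hadm Fr hFr' ((1 - X) ^ 2) hPz (p ^ N * u) ha'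
    (isOpen_rootsOfUnityFixer ℚ _)
  obtain ⟨y', rfl⟩ := oneCocycleClass_surjective _ y
  refine ⟨hqp, hunr, hdvd, u, y', hu, fun r hr x ↦ ?_, fun w hw 𝔓' h𝔓' ↦ ?_, fun φ hφ ↦ ?_⟩
  · -- (act): `ρ_{p^{k+1}}(res r) = 1` and `κ(res r) = κ(Fr)`
    have hρ1 : W.torsionGaloisModule ((p : ℤ) ^ (k + 1)) (absGaloisRestrict ℚ (q.adicCompletion ℚ) r) = 1 :=
      (StepsTwoFourTransport.isSplit_and_depth_absGaloisRestrict_of_isArithFrobAt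
        (W.torsionGaloisModule ((p : ℤ) ^ (k + 1))) κ hunr hqp h𝔓 hFr
        (torsionGaloisModule_eq_one_of_galoisRepTorsion_eq_one W hsplit) hFrN hFrN' hr).1
    have hexp : κ.twistExponent n' (absGaloisRestrict ℚ (q.adicCompletion ℚ) r) = p ^ N * u := by
      rw [← ha]
      unfold ZpExtension.twistExponent
      rw [TameClass.apply_absGaloisRestrict_eq_of_isArithFrobAt κ hqp h𝔓 hFr hr]
    rw [κ.twistModPk_apply_of_level _ _ L hadm, hexp]
    congr 1
    funext i
    rw [hρ1]
    rfl
  · exact (mem_integralH1_iff _ p _ _).1 hyint w (TameClass.primesEquiv_ne_of_natCast_not_mem hw) 𝔓' h𝔓'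
  · obtain ⟨ψ, hψ, hclass⟩ := hynorm φ hφ
    refine ⟨ψ, fun g ↦ ?_, hclass⟩
    rw [hψ g, TameClass.aeval_one_sub_X_sq_apply]

end Summit.BirchSwinnertonDyer.BirchSwinnertonDyer.Theorems.OneSidedTwistSqueezeX9KatoDivisibilityX9KolyvaginReciprocityPkValueInput

end
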